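import Mathlib
import HarnessLib
import Summits.RiemannHypothesis.RiemannHypothesis.Theorems.IntegerScrewRungFour

/-!
# The screw matrices are not sign-regular: `S_4` is not `TP₂` (negative lemma, RH-free)

Negative-side lemma for the `IntegerScrew` line (W-06 cycle 4, cell C3⁴-bis «sign-regularity lens»,
rh-idea-3 g14; critic verdict rh-split-ref-2 g12, ideators/INBOX 2026-08-29T02:58:12Z).
QUESTION KILLED: could `S_M ⪰ 0` (⇔ RH over all `M`, `IntegerScrewPSD`) come from a MULTIPLICATIVE
sign structure — total nonnegativity / Gantmacher–Krein oscillation / checkerboard inverse — which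
would give positivity by Cauchy–Binet and Perron–Frobenius instead of by cancellation?  NO: the
`4 × 4` screw matrix `S_4 = screwMatrix 3` (nodes `log 2, log 3, log 4`) already has a NEGATIVE
`2 × 2` minor, rows `(log 2, log 3)` × columns `(log 3, log 4)`:
`K(2,3)·K(3,4) − K(2,4)·K(3,3) = −4.52·10⁻⁴` (certified `< −1.4·10⁻⁴`).
INPUTS: the public brackets `zetaScrew_log_{two,three,three_halves,four,four_thirds}_sub_bounds`
(`Ψ(log x) − C/4` to `±6·10⁻⁴`, `IntegerScrewRungThree/Four`) and a sharpened lower bound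
`quarter_sq_tsum_ge : 17.196 ≤ C = Σ_k (k+¼)^{−2}` (twenty terms + telescoping tail `4/81`; the tree
so far used only the twenty-term bound `17.1467`).  METHOD: with `r = Ψ(log 4)`,
`α = Ψ(log 2)+Ψ(log 3)−Ψ(log 3/2)−Ψ(log 4)`, `β = Ψ(log 3)−Ψ(log 4)`, `γ = Ψ(log 4)−Ψ(log 4/3)`
(`C/4` cancels in `α, β, γ`) the minor is `−r² + r(α+γ−β) + α(β+γ) ≤ −0.0215·r + 0.000886 < 0`
for `r ≥ 0.0478`.  Structural reason (informal): `Ψ(t) ≈ (|t|/2)·log(1/|t|)` at `0` is not a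
Green's kernel, so the Brownian/oscillation-matrix model `[min(log m, log m′)]` fails at leading order.
Main: `quarter_sq_tsum_ge`, `S4_entries`, **`S4_minor_neg`**, **`not_TP2_S4`**, `not_screwTP2All`.
All statements `sorry`-free; standard axioms.  Nothing here bears on the truth of RH.
-/

noncomputable section

-- D-0017: `Summit.<S>.<S>.…` is the designed namespace of a single-problem summit.
set_option linter.dupNamespace false

namespace Summit.RiemannHypothesis.RiemannHypothesis.Theorems.IntegerScrew

open Literature.NumberTheory.LFunctions Filter Topology
open scoped BigOperators


/-- `2 × 2` total positivity of a real square matrix: every `2 × 2` minor with increasing row and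
column indices is `≥ 0`. [folklore] -/
def TP2 {n : ℕ} (A : Matrix (Fin n) (Fin n) ℝ) : Prop :=
  ∀ i k j l : Fin n, i < k → j < l → 0 ≤ A i j * A k l - A i l * A k j

/-- `C = Σ_k (k+¼)^{−2} ≥ 17.196`: twenty terms (`≥ 17.1467`, as in the tree) plus the
telescoping tail bound `Σ_{k ≥ 20} (k+¼)^{−2} ≥ Σ_{k ≥ 20} [(k+¼)^{−1} − (k+5/4)^{−1}] = 4/81`.
(`C = ψ′(¼) = π² + 8G = 17.19733…`.) [folklore] -/
theorem quarter_sq_tsum_ge : (17.196 : ℝ) ≤ ∑' k : ℕ, 1 / ((k : ℝ) + 1 / 4) ^ 2 := by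
  set f : ℕ → ℝ := fun k => 1 / ((k : ℝ) + 1 / 4) ^ 2 with hf
  have hs : Summable f := summable_one_div_nat_add_quarter_sq
  have h20 : (17.1467 : ℝ) ≤ ∑ i ∈ Finset.range 20, f i := by
    simp only [hf]; norm_num [Finset.sum_range_succ]
  set g : ℕ → ℝ := fun i => 1 / ((i : ℝ) + 81 / 4) - 1 / ((i : ℝ) + 85 / 4) with hg
  have hg0 : ∀ i, 0 ≤ g i := by
    intro i; simp only [hg]; rw [sub_nonneg]
    exact one_div_le_one_div_of_le (by positivity) (by linarith)
  have hpart : ∀ n : ℕ, ∑ i ∈ Finset.range n, g i = 4 / 81 - 1 / ((n : ℝ) + 81 / 4) := by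
    intro n
    induction n with
    | zero => norm_num
    | succ n ih =>
      rw [Finset.sum_range_succ, ih]
      simp only [hg]; push_cast
      have h1 : (n : ℝ) + 85 / 4 = (n : ℝ) + 1 + 81 / 4 := by ring
      rw [h1]; ring
  have ht : Tendsto (fun n : ℕ => (1 : ℝ) / ((n : ℝ) + 81 / 4)) atTop (𝓝 0) :=
    tendsto_const_nhds.div_atTop (tendsto_natCast_atTop_atTop.atTop_add tendsto_const_nhds)
  have hgsum : HasSum g (4 / 81) := by
    rw [hasSum_iff_tendsto_nat_of_nonneg hg0]
    have : (fun n : ℕ => ∑ i ∈ Finset.range n, g i) =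
        fun n : ℕ => 4 / 81 - 1 / ((n : ℝ) + 81 / 4) := funext hpart
    rw [this]; simpa using tendsto_const_nhds.sub ht
  have hle : ∀ i : ℕ, g i ≤ f (i + 20) := by
    intro i; simp only [hf, hg]; push_cast
    have hx : (0 : ℝ) < (i : ℝ) + 81 / 4 := by positivity
    have e1 : 1 / ((i : ℝ) + 81 / 4) - 1 / ((i : ℝ) + 85 / 4)
        = 1 / (((i : ℝ) + 81 / 4) * ((i : ℝ) + 85 / 4)) := by
      field_simp; ring
    have e2 : ((i : ℝ) + 20 + 1 / 4) ^ 2 = ((i : ℝ) + 81 / 4) * ((i : ℝ) + 81 / 4) := by ring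
    rw [e1, e2]
    exact one_div_le_one_div_of_le (by positivity) (by nlinarith)
  have htail : (4 / 81 : ℝ) ≤ ∑' i, f (i + 20) := by
    rw [← hgsum.tsum_eq]
    exact hgsum.summable.tsum_le_tsum hle ((summable_nat_add_iff 20).mpr hs)
  rw [← hs.sum_add_tsum_nat_add 20]
  linarith

/-- The four entries of `S_4 = screwMatrix 3` (nodes `log 2, log 3, log 4`) entering the witness
minor, in closed `Ψ`-form. [folklore] -/
theorem S4_entries :
    screwMatrix 3 0 1
        = zetaScrew (Real.log 2) + zetaScrew (Real.log 3) - zetaScrew (Real.log (3 / 2)) ∧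
    screwMatrix 3 1 2
        = zetaScrew (Real.log 3) + zetaScrew (Real.log 4) - zetaScrew (Real.log (4 / 3)) ∧
    screwMatrix 3 0 2 = zetaScrew (Real.log 4) ∧
    screwMatrix 3 1 1 = 2 * zetaScrew (Real.log 3) := by
  have hlog23 : Real.log 2 - Real.log 3 = -Real.log (3 / 2) := by
    rw [Real.log_div (by norm_num) (by norm_num)]; ring
  have hl4 : Real.log 4 = 2 * Real.log 2 := by
    rw [show (4:ℝ) = 2 ^ 2 by norm_num, Real.log_pow]; norm_num
  have hlog24 : Real.log 2 - Real.log 4 = -Real.log 2 := by rw [hl4]; ring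
  have hlog34 : Real.log 3 - Real.log 4 = -Real.log (4 / 3) := by
    rw [Real.log_div (by norm_num) (by norm_num)]; ring
  have h12 : zetaScrewKernel (Real.log 2) (Real.log 3)
      = zetaScrew (Real.log 2) + zetaScrew (Real.log 3) - zetaScrew (Real.log (3 / 2)) := by
    rw [zetaScrewKernel_def, hlog23, zetaScrew_neg]
  have h13 : zetaScrewKernel (Real.log 2) (Real.log 4) = zetaScrew (Real.log 4) := by
    rw [zetaScrewKernel_def, hlog24, zetaScrew_neg]; ring
  have h23 : zetaScrewKernel (Real.log 3) (Real.log 4)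
      = zetaScrew (Real.log 3) + zetaScrew (Real.log 4) - zetaScrew (Real.log (4 / 3)) := by
    rw [zetaScrewKernel_def, hlog34, zetaScrew_neg]
  have c0 : (((((0 : Fin 3) : ℕ) + 2 : ℕ)) : ℝ) = 2 := by norm_num
  have c1 : (((((1 : Fin 3) : ℕ) + 2 : ℕ)) : ℝ) = 3 := by norm_num
  have c2 : (((((2 : Fin 3) : ℕ) + 2 : ℕ)) : ℝ) = 4 := by norm_num
  refine ⟨?_, ?_, ?_, ?_⟩ <;>
    simp only [screwMatrix_apply, c0, c1, c2, zetaScrewKernel_self, h12, h13, h23]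

/-- **The witness minor is negative**: rows `(2,3)` × columns `(3,4)` of `S_4`,
`K₂₃·K₃₄ − K₂₄·K₃₃ < 0` (numerically `−4.52·10⁻⁴`; certified here `< −1.4·10⁻⁴`), from the
brackets of `IntegerScrewRungThree/Four` and `quarter_sq_tsum_ge`. RH-free. [folklore] -/
theorem S4_minor_neg :
    screwMatrix 3 0 1 * screwMatrix 3 1 2 - screwMatrix 3 0 2 * screwMatrix 3 1 1 < 0 := by
  obtain ⟨e01, e12, e02, e11⟩ := S4_entries
  rw [e01, e12, e02, e11]
  have hC := quarter_sq_tsum_ge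
  have h2 := zetaScrew_log_two_sub_bounds
  have h3 := zetaScrew_log_three_sub_bounds
  have h32 := zetaScrew_log_three_halves_sub_bounds
  have h4 := zetaScrew_log_four_sub_bounds
  have h43 := zetaScrew_log_four_thirds_sub_bounds
  set C : ℝ := ∑' k : ℕ, 1 / ((k : ℝ) + 1 / 4) ^ 2 with hCdef
  set a : ℝ := zetaScrew (Real.log 2) with ha
  set b : ℝ := zetaScrew (Real.log 3) with hb
  set w : ℝ := zetaScrew (Real.log (3 / 2)) with hw
  set d : ℝ := zetaScrew (Real.log 4) with hd
  set v : ℝ := zetaScrew (Real.log (4 / 3)) with hv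
  -- r = d ≥ 0.0478 ; α = a+b-w-d ∈ [0.0399, 0.0432] ; β = b-d ∈ [0.0177, 0.0197] ; γ = d-v ∈ [-0.0006, 0.0008]
  have hr : (0.0478 : ℝ) ≤ d := by linarith [h4.1]
  have hα1 : a + b - w - d ≤ 0.0432 := by linarith [h2.2, h3.2, h32.1, h4.1]
  have hα0 : (0.0399 : ℝ) ≤ a + b - w - d := by linarith [h2.1, h3.1, h32.2, h4.2]
  have hβ0 : (0.0177 : ℝ) ≤ b - d := by linarith [h3.1, h4.2]
  have hβ1 : b - d ≤ 0.0197 := by linarith [h3.2, h4.1]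
  have hγ0 : (-0.0006 : ℝ) ≤ d - v := by linarith [h4.1, h43.2]
  have hγ1 : d - v ≤ 0.0008 := by linarith [h4.2, h43.1]
  -- minor = -d² + d(α+γ-β) + α(β+γ)
  have key : (a + b - w) * (b + d - v) - d * (2 * b)
      = -(d * d) + d * ((a + b - w - d) + (d - v) - (b - d)) + (a + b - w - d) * ((b - d) + (d - v)) := by
    ring
  rw [key]
  have p1 : d * ((a + b - w - d) + (d - v) - (b - d)) ≤ d * 0.0263 :=
    mul_le_mul_of_nonneg_left (by linarith) (by linarith)
  have p2 : (a + b - w - d) * ((b - d) + (d - v)) ≤ 0.0432 * ((b - d) + (d - v)) :=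
    mul_le_mul_of_nonneg_right hα1 (by linarith)
  have p3 : 0.0478 * d ≤ d * d := mul_le_mul_of_nonneg_right hr (by linarith)
  nlinarith [p1, p2, p3, hr, hβ1, hγ1]

/-- **`S_4` is not `TP₂`**: the screw matrices are positive definite (so far as certified, and for all
`M` under RH) WITHOUT being sign-regular — already the `4 × 4` one has a negative `2 × 2` minor.
RH-free. [folklore] -/
theorem not_TP2_S4 : ¬ TP2 (screwMatrix 3) := by
  intro h
  have h' := h 0 1 1 2 (by decide) (by decide)
  linarith [S4_minor_neg, h']

/-- The sign-regular strengthening of `S_M ⪰ 0 ∀ M` — «every screw matrix is `TP₂`» — is FALSE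
(witness `n = 3`); stated inline (no named `Prop` constant). RH-free. [folklore] -/
theorem not_screwTP2All : ¬ ∀ n : ℕ, TP2 (screwMatrix n) := fun h => not_TP2_S4 (h 3)

end Summit.RiemannHypothesis.RiemannHypothesis.Theorems.IntegerScrew

end
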